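import Summits.AtomisticToContinuum.HydrodynamicLimit.Theses.LambertianContactSwap
import Summits.AtomisticToContinuum.HydrodynamicLimit.Theorems.LambertianContactSwapSwapGapEntropyTransfer
import Summits.AtomisticToContinuum.HydrodynamicLimit.Theorems.TwoClocksEntropyToHydro
import Literature.MathematicalPhysics.KineticTheory.LambertianHardSphereFlow
import HarnessLib

/-!
# `SwapGap` (stmt-AtomisticToContinuum-11850), line `Sketch`, interface stub T2: the entropy transfer at MATCHED RATES

Helper file (`--supports stmt-AtomisticToContinuum-11850`) of line `Sketch` (card `entropy-relative-to-lambertian-law`) for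
the crux `Summit.AtomisticToContinuum.HydrodynamicLimit.Theses.LambertianContactSwap.SwapGap`, registered stub
`stub_swapGap_of_rates` (T2) of the lead's skeleton v8: for ANY rate `r_N > 0` with `r_N → ∞`, the relative entropy swap
at rate `r_N` (`KL(p_t ‖ q_t)/r_N → 0`, with `p_t := (Φ_N,t)_* P_N`, `q_t := (Λ_N,t)_* (P_N ⊗ γ^ℕ)`) together with
self-averaging of the bounded `1`-Lipschitz Lambertian field statistics at speed `r_N`
(`(P_N ⊗ γ^ℕ){δ < |F(fld Λ_t) − mean|} ≤ C e^{−r_N/C}`) gives `SwapGap`. The landed composition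
`swapGap_of_relEntSwap_of_fieldConcentration` (p106427) is the case `r_N = N + 1`; the proof is the same:

* `tendsto_measure_of_klDiv_div_ofReal_tendsto_zero` — the event transfer at a general real rate: finite measures
  `μ_N, ν_N`, arbitrary sets `A_N`, `ν_N(A_N) ≤ C e^{−r_N/C}`, `KL(μ_N ‖ ν_N)/r_N → 0`, `0 < r_N → ∞` ⟹ `μ_N(A_N) → 0`
  (entropy inequality for events `measureReal_mul_le_toReal_klDiv_add` with `L_N = r_N/(2C)` on the `ν_N`-measurable
  hull, for the eventual `N` with `KL_N < ∞` and `r_N ≥ 1`: `μ_N(A_N) ≤ 2C·KL_N/r_N + 2C²e^{−r_N/(2C)} → 0`);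
* `stub_swapGap_of_rates` — the body of p106427 with this transfer, then `tendsto_integral_sub_of_tendsto_measure`.

prover-line-stmt-AtomisticToContinuum-11850-c4-0 (wave 5 worker, stub T2), cycle 5.
-/

noncomputable section

open MeasureTheory Filter Set Topology InformationTheory
open scoped ENNReal

namespace Summit.AtomisticToContinuum.HydrodynamicLimit.Theorems

open Literature.Analysis.FluidPDE Literature.MathematicalPhysics.KineticTheory
open Summit.AtomisticToContinuum.HydrodynamicLimit.Theses.LambertianContactSwap

/-! ### The event transfer at a general rate -/

/-- **Relative entropy `o(r_N)` + exponential concentration of the reference at speed `r_N` ⟹ convergence in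
probability**, for a general real rate `0 < r_N → ∞` (the version `tendsto_measure_of_klDiv_div_tendsto_zero` is
`r_N = N + 1`). For finite measures `μ_N, ν_N` on arbitrary measurable spaces and arbitrary sets `A_N`: if
`ν_N(A_N) ≤ C e^{-r_N/C}` for all `N` and `KL(μ_N ‖ ν_N)/r_N → 0`, then `μ_N(A_N) → 0`. Proof: replace `A_N` by its
`ν_N`-measurable hull and apply the entropy inequality for events (`measureReal_mul_le_toReal_klDiv_add`) with
`L_N = r_N/(2C)`, for the eventual `N` with `KL_N < ∞` and `r_N ≥ 1`:
`μ_N(A_N) ≤ 2C·KL_N/r_N + 2C²·e^{-r_N/(2C)} → 0`. [cite: KipnisLandim1999, Ch. 6 §1] -/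
theorem tendsto_measure_of_klDiv_div_ofReal_tendsto_zero {Ω : ℕ → Type*} [∀ N, MeasurableSpace (Ω N)]
    (μ ν : ∀ N, Measure (Ω N)) [∀ N, IsFiniteMeasure (μ N)] [∀ N, IsFiniteMeasure (ν N)]
    (A : ∀ N, Set (Ω N)) {r : ℕ → ℝ} (hr : ∀ N, 0 < r N) (hr' : Tendsto r atTop atTop)
    {C : ℝ} (hC : 0 < C)
    (hconc : ∀ N : ℕ, ν N (A N) ≤ ENNReal.ofReal (C * Real.exp (-(C⁻¹ * r N))))
    (hkl : Tendsto (fun N : ℕ => klDiv (μ N) (ν N) / ENNReal.ofReal (r N)) atTop (𝓝 0)) :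
    Tendsto (fun N : ℕ => μ N (A N)) atTop (𝓝 0) := by
  -- real-valued relative entropy and its normalisation by the rate
  set k : ℕ → ℝ := fun N => (klDiv (μ N) (ν N)).toReal with hk
  have hk_tendsto : Tendsto (fun N : ℕ => k N / r N) atTop (𝓝 0) := by
    have h := (ENNReal.tendsto_toReal ENNReal.zero_ne_top).comp hkl
    rw [ENNReal.toReal_zero] at h
    refine h.congr' (Eventually.of_forall fun N => ?_)
    simp only [Function.comp_apply, hk]
    rw [ENNReal.toReal_div, ENNReal.toReal_ofReal (hr N).le]
  -- eventually the relative entropy is finite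
  have hfin : ∀ᶠ N : ℕ in atTop, klDiv (μ N) (ν N) ≠ ∞ := by
    filter_upwards [hkl.eventually (gt_mem_nhds zero_lt_one)] with N hN
    intro htop
    rw [htop, ENNReal.top_div_of_ne_top ENNReal.ofReal_ne_top] at hN
    exact absurd hN (by simp)
  -- eventually the rate is at least one
  have hr1 : ∀ᶠ N : ℕ in atTop, 1 ≤ r N := hr'.eventually_ge_atTop 1
  -- the real upper bound and its limit
  set B : ℕ → ℝ := fun N =>
    2 * C * (k N / r N) + 2 * C ^ 2 * Real.exp (-(r N / (2 * C))) with hB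
  have hB_tendsto : Tendsto B atTop (𝓝 0) := by
    have h1 : Tendsto (fun N : ℕ => 2 * C * (k N / r N)) atTop (𝓝 0) := by
      simpa using hk_tendsto.const_mul (2 * C)
    have h2 : Tendsto (fun N : ℕ => 2 * C ^ 2 * Real.exp (-(r N / (2 * C)))) atTop (𝓝 0) := by
      have hdiv : Tendsto (fun N : ℕ => r N / (2 * C)) atTop atTop :=
        hr'.atTop_div_const (by positivity)
      have hexp := Real.tendsto_exp_neg_atTop_nhds_zero.comp hdiv
      simpa using hexp.const_mul (2 * C ^ 2)
    simpa using h1.add h2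
  have hB_ennreal : Tendsto (fun N => ENNReal.ofReal (B N)) atTop (𝓝 0) := by
    simpa using ENNReal.tendsto_ofReal hB_tendsto
  -- the eventual pointwise bound `μ_N(A_N) ≤ B_N`
  have hbound : ∀ᶠ N : ℕ in atTop, μ N (A N) ≤ ENNReal.ofReal (B N) := by
    filter_upwards [hfin, hr1] with N hN hrN
    set A' : Set (Ω N) := toMeasurable (ν N) (A N) with hA'
    have hA'm : MeasurableSet A' := measurableSet_toMeasurable _ _
    have hrpos : 0 < r N := hr N
    have hr0 : r N ≠ 0 := hrpos.ne'
    set L : ℝ := r N / (2 * C) with hL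
    have hLpos : 0 < L := by positivity
    -- reference mass of the hull
    have hq : (ν N).real A' ≤ C * Real.exp (-(C⁻¹ * r N)) := by
      rw [measureReal_def, hA', measure_toMeasurable]
      exact ENNReal.toReal_le_of_le_ofReal (by positivity) (hconc N)
    have hq0 : 0 ≤ (ν N).real A' := measureReal_nonneg
    -- entropy inequality for the event `A'`
    have hent := measureReal_mul_le_toReal_klDiv_add hN hA'm L
    have hexpL : (Real.exp L - 1) * (ν N).real A' ≤ C * Real.exp (-(r N / (2 * C))) := by
      calc (Real.exp L - 1) * (ν N).real A'
          ≤ Real.exp L * (ν N).real A' := by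
            apply mul_le_mul_of_nonneg_right (by linarith [Real.exp_pos L]) hq0
        _ ≤ Real.exp L * (C * Real.exp (-(C⁻¹ * r N))) :=
            mul_le_mul_of_nonneg_left hq (Real.exp_pos L).le
        _ = C * (Real.exp L * Real.exp (-(C⁻¹ * r N))) := by ring
        _ = C * Real.exp (-(r N / (2 * C))) := by
            have hLid : L + -(C⁻¹ * r N) = -(r N / (2 * C)) := by
              rw [hL]
              field_simp
              ring
            rw [← Real.exp_add, hLid]
    have hm0 : 0 ≤ (μ N).real A' := measureReal_nonneg
    have hk0 : 0 ≤ k N := ENNReal.toReal_nonneg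
    have hmain : (μ N).real A' * L ≤ k N + C * Real.exp (-(r N / (2 * C))) := by
      simp only [hk]
      linarith
    have hmB : (μ N).real A' ≤ B N := by
      have h1 : (μ N).real A' ≤ (k N + C * Real.exp (-(r N / (2 * C)))) / L :=
        (le_div_iff₀ hLpos).mpr hmain
      have h2 : (k N + C * Real.exp (-(r N / (2 * C)))) / L =
          2 * C * (k N / r N) + 2 * C ^ 2 * Real.exp (-(r N / (2 * C))) / r N := by
        rw [hL]
        field_simp
      have h3 : 2 * C ^ 2 * Real.exp (-(r N / (2 * C))) / r N ≤
          2 * C ^ 2 * Real.exp (-(r N / (2 * C))) :=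
        div_le_self (by positivity) hrN
      rw [hB]
      linarith
    calc μ N (A N) ≤ μ N A' := measure_mono (subset_toMeasurable _ _)
      _ = ENNReal.ofReal ((μ N).real A') := (ofReal_measureReal (measure_ne_top _ _)).symm
      _ ≤ ENNReal.ofReal (B N) := ENNReal.ofReal_le_ofReal hmB
  exact tendsto_of_tendsto_of_tendsto_of_le_of_le' tendsto_const_nhds hB_ennreal
    (Eventually.of_forall fun N => zero_le) hbound

/-! ### The transfer at matched rates -/

/-- **T2 · `SwapGap` from the relative entropy swap and Lambertian self-averaging AT MATCHED RATES**: for any rate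
`r_N > 0` with `r_N → ∞`, if `KL(p_t ‖ q_t)/r_N → 0` (with `p_t := (Φ_N,t)_* P_N`, `q_t := (Λ_N,t)_* (P_N ⊗ γ^ℕ)`)
and every bounded `1`-Lipschitz statistic `F ∘ fld(·, χ)` of the three `χ`-tested empirical fields of `Λ_t` satisfies
`(P_N ⊗ γ^ℕ){δ < |F(fld Λ_t) − mean|} ≤ C e^{−r_N/C}`, then `SwapGap`. Proof (the body of
`swapGap_of_relEntSwap_of_fieldConcentration`, p106427, which is the case `r_N = N + 1`): `σ₀ := min (1/2) (min σ₁ σ₂)`;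
for `σ < σ₀`, Euler data, flows, the `t = 0` hypothesis, `t < T`, `χ`, `F`, put `G := F ∘ fld(·, χ)` (measurable,
`|G| ≤ 1`), `μ_N := p_t`, `ν_N := q_t` (finite; `Λ_t` jointly measurable for `σ < 1/2`,
`measurable_lambertFlow_hsDiameter`), `m_N := ∫ G dν_N`; the second hypothesis gives `ν_N{δ < |G − m_N|} ≤ C e^{−r_N/C}`,
the first `KL(μ_N ‖ ν_N)/r_N → 0`, so the event transfer at rate `r_N`
(`tendsto_measure_of_klDiv_div_ofReal_tendsto_zero`) gives `P_N{δ < |G(Φ_t z) − m_N|} = μ_N{δ < |G − m_N|} → 0` for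
every `δ > 0`, and boundedness (`tendsto_integral_sub_of_tendsto_measure`) gives `∫ G(Φ_t z) dP_N − m_N → 0`, the crux
(`m_N` is literally its Lambertian term: the route's inline `let` block is the Literature API definitionally).
[cite: KipnisLandim1999, Ch. 6 §1] -/
theorem stub_swapGap_of_rates (r : ℕ → ℝ) (hr : ∀ N, 0 < r N) (hr' : Tendsto r atTop atTop)
    (h1 : ∀ (a₀ θ₀ : T3 → ℝ) (u₀ : T3 → V3), Continuous a₀ → Continuous θ₀ → Continuous u₀ →
      (∀ x, 0 < a₀ x) → (∀ x, 0 < θ₀ x) →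
      ∃ σ₀ : ℝ, 0 < σ₀ ∧ ∀ σ : ℝ, 0 < σ → σ < σ₀ →
        ∀ (T : ℝ) (ρ θ : ℝ → T3 → ℝ) (u : ℝ → T3 → V3), IsHardSphereEulerSolution σ T ρ u θ →
          ∀ Φ : (N : ℕ) → HardSphereFlow (Torus.geometry (Fin 3)) (hsDiameter σ N) (N + 1),
            TendstoHydroFieldsAt (fun N => localGibbsLaw σ a₀ u₀ θ₀ N (Φ N)) Φ ρ u θ 0 →
              ∀ t ∈ Set.Ico 0 T,
                Tendsto (fun N : ℕ =>
                  klDiv ((localGibbsLaw σ a₀ u₀ θ₀ N (Φ N)).map ((Φ N).flow t))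
                    (((localGibbsLaw σ a₀ u₀ θ₀ N (Φ N)).prod (lambertNoise (Fin 3))).map
                      (fun p => lambertFlow (Torus.geometry (Fin 3)) (hsDiameter σ N) p.2 p.1 t)) /
                  ENNReal.ofReal (r N)) atTop (𝓝 0))
    (h2 : ∀ (a₀ θ₀ : T3 → ℝ) (u₀ : T3 → V3), Continuous a₀ → Continuous θ₀ → Continuous u₀ →
      (∀ x, 0 < a₀ x) → (∀ x, 0 < θ₀ x) →
      ∃ σ₀ : ℝ, 0 < σ₀ ∧ ∀ σ : ℝ, 0 < σ → σ < σ₀ →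
        ∀ (T : ℝ) (ρ θ : ℝ → T3 → ℝ) (u : ℝ → T3 → V3), IsHardSphereEulerSolution σ T ρ u θ →
          ∀ Φ : (N : ℕ) → HardSphereFlow (Torus.geometry (Fin 3)) (hsDiameter σ N) (N + 1),
            TendstoHydroFieldsAt (fun N => localGibbsLaw σ a₀ u₀ θ₀ N (Φ N)) Φ ρ u θ 0 →
              ∀ t ∈ Set.Ico 0 T, ∀ χ : T3 → ℝ, Continuous χ →
                ∀ F : ℝ × V3 × ℝ → ℝ, LipschitzWith 1 F → (∀ y, |F y| ≤ 1) → ∀ δ : ℝ, 0 < δ →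
                  ∃ C : ℝ, 0 < C ∧ ∀ N : ℕ,
                    ((localGibbsLaw σ a₀ u₀ θ₀ N (Φ N)).prod (lambertNoise (Fin 3)))
                      {p | δ < |F (empiricalDensityField
                              (lambertFlow (Torus.geometry (Fin 3)) (hsDiameter σ N) p.2 p.1 t) χ,
                            empiricalMomentumField
                              (lambertFlow (Torus.geometry (Fin 3)) (hsDiameter σ N) p.2 p.1 t) χ,
                            empiricalEnergyField
                              (lambertFlow (Torus.geometry (Fin 3)) (hsDiameter σ N) p.2 p.1 t) χ) -
                          ∫ q, F (empiricalDensityField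
                              (lambertFlow (Torus.geometry (Fin 3)) (hsDiameter σ N) q.2 q.1 t) χ,
                            empiricalMomentumField
                              (lambertFlow (Torus.geometry (Fin 3)) (hsDiameter σ N) q.2 q.1 t) χ,
                            empiricalEnergyField
                              (lambertFlow (Torus.geometry (Fin 3)) (hsDiameter σ N) q.2 q.1 t) χ)
                            ∂((localGibbsLaw σ a₀ u₀ θ₀ N (Φ N)).prod (lambertNoise (Fin 3)))|} ≤
                      ENNReal.ofReal (C * Real.exp (-(C⁻¹ * r N)))) :
    SwapGap := by
  delta Summit.AtomisticToContinuum.HydrodynamicLimit.Theses.LambertianContactSwap.SwapGap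
  intro Cfg G ε τ S ldir lpair lstep lstate linst lflow noise fld a₀ θ₀ u₀ ha hθ hu ha0 hθ0
  obtain ⟨σ₁, hσ₁, h1'⟩ := h1 a₀ θ₀ u₀ ha hθ hu ha0 hθ0
  obtain ⟨σ₂, hσ₂, h2'⟩ := h2 a₀ θ₀ u₀ ha hθ hu ha0 hθ0
  refine ⟨min 2⁻¹ (min σ₁ σ₂), lt_min (by norm_num) (lt_min hσ₁ hσ₂), ?_⟩
  intro σ hσ hσlt T ρ θ u hE Φ P h0 t ht χ hχ F hF hF1
  have hσhalf : σ < 2⁻¹ := hσlt.trans_le (min_le_left _ _)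
  have hσ₁' : σ < σ₁ := hσlt.trans_le ((min_le_right _ _).trans (min_le_left _ _))
  have hσ₂' : σ < σ₂ := hσlt.trans_le ((min_le_right _ _).trans (min_le_right _ _))
  -- the laws
  have hPN : ∀ N, IsProbabilityMeasure (P N) := fun N =>
    isProbabilityMeasure_localGibbsLaw ha hθ hu ha0 hθ0 (by linarith) N (Φ N)
  have hnoise : IsProbabilityMeasure noise := by
    show IsProbabilityMeasure (lambertNoise (Fin 3))
    infer_instance
  -- measurability of the Lambertian flow (the `let` block is the Literature API definitionally)
  have hΛ : ∀ N, Measurable fun p : Cfg N × (ℕ → EuclideanSpace ℝ (Fin 3)) => lflow σ N p.2 p.1 t :=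
    fun N => measurable_lambertFlow_hsDiameter hσ.le hσhalf N t
  -- the bounded measurable statistic `G_N = F ∘ fld`
  have hfld : ∀ N, Measurable fun y : Cfg N => fld N y χ := fun N => measurable_fieldTriple hχ
  have hG : ∀ N, Measurable fun y : Cfg N => F (fld N y χ) :=
    fun N => hF.continuous.measurable.comp (hfld N)
  -- the two image laws
  set μ : (N : ℕ) → Measure (Cfg N) := fun N => (P N).map ((Φ N).flow t) with hμ
  set ν : (N : ℕ) → Measure (Cfg N) := fun N =>
    ((P N).prod noise).map (fun p => lflow σ N p.2 p.1 t) with hν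
  haveI hμfin : ∀ N, IsFiniteMeasure (μ N) := fun N => by
    haveI := hPN N
    exact Measure.isFiniteMeasure_map _ _
  haveI hνfin : ∀ N, IsFiniteMeasure (ν N) := fun N => by
    haveI := hPN N
    exact Measure.isFiniteMeasure_map _ _
  -- the Lambertian means
  set m : ℕ → ℝ := fun N => ∫ p, F (fld N (lflow σ N p.2 p.1 t) χ) ∂((P N).prod noise) with hm
  have hm1 : ∀ N, |m N| ≤ 1 := fun N => by
    haveI := hPN N
    have h := norm_integral_le_of_norm_le_const (μ := (P N).prod noise)
      (f := fun p : Cfg N × (ℕ → EuclideanSpace ℝ (Fin 3)) => F (fld N (lflow σ N p.2 p.1 t) χ))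
      (C := 1) (ae_of_all _ fun p => by
        rw [Real.norm_eq_abs]
        exact hF1 _)
    simpa [hm, Real.norm_eq_abs] using h
  -- first hypothesis: `KL(μ_N ‖ ν_N)/r_N → 0`
  have hkl : Tendsto (fun N : ℕ => klDiv (μ N) (ν N) / ENNReal.ofReal (r N)) atTop (𝓝 0) :=
    h1' σ hσ hσ₁' T ρ θ u hE Φ h0 t ht
  -- convergence in `P_N`-probability of `G(Φ_t z)` towards the Lambertian mean
  have hprob : ∀ δ : ℝ, 0 < δ →
      Tendsto (fun N => P N {z | δ < |F (fld N ((Φ N).flow t z) χ) - m N|}) atTop (𝓝 0) := by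
    intro δ hδ
    obtain ⟨C, hC, hconc⟩ := h2' σ hσ hσ₂' T ρ θ u hE Φ h0 t ht χ hχ F hF hF1 δ hδ
    set A : (N : ℕ) → Set (Cfg N) := fun N => {y | δ < |F (fld N y χ) - m N|} with hA
    have hAm : ∀ N, MeasurableSet (A N) := fun N =>
      measurableSet_lt measurable_const ((hG N).sub measurable_const).abs
    have hνA : ∀ N, ν N (A N) ≤ ENNReal.ofReal (C * Real.exp (-(C⁻¹ * r N))) := by
      intro N
      rw [hν, Measure.map_apply (hΛ N) (hAm N)]
      exact hconc N
    have hμA := tendsto_measure_of_klDiv_div_ofReal_tendsto_zero μ ν A hr hr' hC hνA hkl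
    refine hμA.congr fun N => ?_
    rw [hμ, Measure.map_apply ((Φ N).measurable_flow t) (hAm N)]
    rfl
  -- merging of the means
  have hmerge := tendsto_integral_sub_of_tendsto_measure P hPN
    (fun N z => F (fld N ((Φ N).flow t z) χ)) (fun N => (hG N).comp ((Φ N).measurable_flow t))
    (fun N z => hF1 _) m hm1 hprob
  exact hmerge

end Summit.AtomisticToContinuum.HydrodynamicLimit.Theorems
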